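import Mathlib
import Summits.ValiantsHypothesis.ValiantsHypothesis.Theorems.TwoProducts.Negative.FullPaddingResidual
import HarnessLib

/-!
# NEGATIVE lane (val-neg-1 g5): idea-34's K1 `GaugeInertThresholds` (`ResidualInstanceCellLaw → CellLaw`), token-exact, by name

Helper file for crux `stmt-ValiantsHypothesis-5906` (filed `--supports`; closes NO item, proves NO summit statement, does NOT prove
`TwoProducts`, `PlanarCellBound`, `CellLaw`, any `ResidualLawV…` or VP ≠ VNP; 0 `def`s).

val-idea-34's crux idea `factor-gauge-rigidity` (card `Cruxes/TwoProducts/Ideas/factor-gauge-rigidity.md`, sketch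
`Cruxes/TwoProducts/ValIdea34GaugeSketch.lean`) types its first lemma K1 as `GaugeInertThresholds : Prop := ResidualInstanceCellLaw → CellLaw`
(per-cell law demanded only of instances with HYP1 `NoSmallPermMerge`, HYP2 `NoCheapClassCover` and no rank-one datum ⇒ hypothesis-free per-cell law;
director R282 (7)(f) booked it for this lane).  It is a COROLLARY of the landed `FullPaddingResidual.residualNoDatum_iff_planarCellBound` (p650663):
below, `gaugeInertThresholds` has as hypothesis the text of `ResidualInstanceCellLaw` with `NoSmallPermMerge`/`NoCheapClassCover` unfolded
token-for-token (datum clause in idea-34's `∀ ρp ρm, ¬ …` form) and as conclusion the text of `CellLaw` verbatim; exponents `(a, b) ↦ (9a, b + 64a)`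
(the card estimated `(51a, b + 26a)`).  `residualInstanceCellLaw_iff_cellLaw`: the two laws are equivalent.  In the Cruxes sketch,
`theorem k1 : GaugeInertThresholds := fun h => gaugeInertThresholds h` should elaborate after `unfold` of the three defs (not checked here: Cruxes
modules are not built on the farm).  [folklore]
-/

namespace Summit.ValiantsHypothesis.Theorems.TwoProducts.Negative.GaugeInertThresholds

open Finset MvPolynomial
open Summit.ValiantsHypothesis.ValiantsHypothesis.Theorems.NewtonUnitEquations.TwoProducts.FormalLogLinearisation
open Summit.ValiantsHypothesis.ValiantsHypothesis.Theorems.NewtonUnitEquations.TwoProducts.PlanarCell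
open Summit.ValiantsHypothesis.ValiantsHypothesis.Theorems.NewtonUnitEquations.TwoProducts.PermutationType
  (msetT PermType RankOneCoincidences)
open Summit.ValiantsHypothesis.Theorems.TwoProducts.Negative.FullPaddingResidual (residualNoDatum_iff_planarCellBound)

/-- **K1 of `factor-gauge-rigidity` (idea-34 `GaugeInertThresholds`, texts verbatim / unfolded): `ResidualInstanceCellLaw → CellLaw`.** [folklore] -/
theorem gaugeInertThresholds
    (h : ∃ a b : ℕ, ∀ (m t : ℕ), 2 ≤ t → ∀ (u v : Fin m → MvPolynomial (Fin 2) ℂ),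
      (∀ j, coeff 0 (u j) = 0 ∧ (u j).support.card ≤ t) → (∀ j, coeff 0 (v j) = 0 ∧ (v j).support.card ≤ t) →
      (∀ (J : Finset (Fin m)) (j₀ : Fin m), j₀ ∈ J →
        BlockSmall (fun j => (u j).support ∪ (v j).support) J (2 ^ m * (t + 2) ^ 4) →
        ¬ PermType (mergeA (fun j => (u j).support ∪ (v j).support) J j₀)) →
      (∀ (r : ℕ) (Jc : Fin r → Finset (Fin m)) (ac bc : Fin r → Fin m → Expo),
        (∀ a ∈ tuples (fun j => (u j).support ∪ (v j).support), ∀ b ∈ tuples (fun j => (u j).support ∪ (v j).support),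
          a ≠ b → ∑ j, a j = ∑ j, b j →
          ∃ k : Fin r, (∀ j, a j ≠ b j ↔ j ∈ Jc k) ∧
            ((∀ j ∈ Jc k, a j = ac k j ∧ b j = bc k j) ∨ (∀ j ∈ Jc k, a j = bc k j ∧ b j = ac k j))) →
        2 ^ m * (t + 2) ^ 4 < 2 * (m + 1) * (3 * (2 + m + m.choose 2) ^ 2) ^ r) →
      (∀ ρp ρm : Expo →₀ ℕ, ¬ RankOneCoincidences (fun j => (u j).support ∪ (v j).support) ρp ρm) →
      ∀ (R : Expo → Expo → Prop) (S : Finset Expo), IsCellFamily u v R S → S.card ≤ 2 ^ (a * m) * (t + 2) ^ b) :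
    ∃ a b : ℕ, ∀ (m t : ℕ), 2 ≤ t → ∀ (u v : Fin m → MvPolynomial (Fin 2) ℂ),
      (∀ j, coeff 0 (u j) = 0 ∧ (u j).support.card ≤ t) → (∀ j, coeff 0 (v j) = 0 ∧ (v j).support.card ≤ t) →
      ∀ (R : Expo → Expo → Prop) (S : Finset Expo), IsCellFamily u v R S → S.card ≤ 2 ^ (a * m) * (t + 2) ^ b := by
  obtain ⟨a, b, h⟩ := h
  obtain ⟨a', b', h'⟩ := residualNoDatum_iff_planarCellBound.1
    ⟨a, b, fun m t ht u v hu hv h5 h1 hnd R S hS => h m t ht u v hu hv h5 h1 (fun ρp ρm hρ => hnd ⟨ρp, ρm, hρ⟩) R S hS⟩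
  exact ⟨a', b', fun m t ht u v hu hv R S hS => h' m t ht u v hu hv R S hS⟩

/-- **`ResidualInstanceCellLaw ↔ CellLaw`** (idea-34 texts; the converse is weakening). [folklore] -/
theorem residualInstanceCellLaw_iff_cellLaw :
    (∃ a b : ℕ, ∀ (m t : ℕ), 2 ≤ t → ∀ (u v : Fin m → MvPolynomial (Fin 2) ℂ),
      (∀ j, coeff 0 (u j) = 0 ∧ (u j).support.card ≤ t) → (∀ j, coeff 0 (v j) = 0 ∧ (v j).support.card ≤ t) →
      (∀ (J : Finset (Fin m)) (j₀ : Fin m), j₀ ∈ J →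
        BlockSmall (fun j => (u j).support ∪ (v j).support) J (2 ^ m * (t + 2) ^ 4) →
        ¬ PermType (mergeA (fun j => (u j).support ∪ (v j).support) J j₀)) →
      (∀ (r : ℕ) (Jc : Fin r → Finset (Fin m)) (ac bc : Fin r → Fin m → Expo),
        (∀ a ∈ tuples (fun j => (u j).support ∪ (v j).support), ∀ b ∈ tuples (fun j => (u j).support ∪ (v j).support),
          a ≠ b → ∑ j, a j = ∑ j, b j →
          ∃ k : Fin r, (∀ j, a j ≠ b j ↔ j ∈ Jc k) ∧
            ((∀ j ∈ Jc k, a j = ac k j ∧ b j = bc k j) ∨ (∀ j ∈ Jc k, a j = bc k j ∧ b j = ac k j))) →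
        2 ^ m * (t + 2) ^ 4 < 2 * (m + 1) * (3 * (2 + m + m.choose 2) ^ 2) ^ r) →
      (∀ ρp ρm : Expo →₀ ℕ, ¬ RankOneCoincidences (fun j => (u j).support ∪ (v j).support) ρp ρm) →
      ∀ (R : Expo → Expo → Prop) (S : Finset Expo), IsCellFamily u v R S → S.card ≤ 2 ^ (a * m) * (t + 2) ^ b) ↔
    (∃ a b : ℕ, ∀ (m t : ℕ), 2 ≤ t → ∀ (u v : Fin m → MvPolynomial (Fin 2) ℂ),
      (∀ j, coeff 0 (u j) = 0 ∧ (u j).support.card ≤ t) → (∀ j, coeff 0 (v j) = 0 ∧ (v j).support.card ≤ t) →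
      ∀ (R : Expo → Expo → Prop) (S : Finset Expo), IsCellFamily u v R S → S.card ≤ 2 ^ (a * m) * (t + 2) ^ b) :=
  ⟨gaugeInertThresholds, fun ⟨a, b, h⟩ => ⟨a, b, fun m t ht u v hu hv _ _ _ R S hS => h m t ht u v hu hv R S hS⟩⟩

end Summit.ValiantsHypothesis.Theorems.TwoProducts.Negative.GaugeInertThresholds
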